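import Mathlib.RingTheory.Smooth.Locus
import Mathlib.RingTheory.Localization.LocalizationLocalization
import Mathlib.RingTheory.Localization.Away.Basic
import HarnessLib

/-!
# Smoothness of the generic fibre in ring form (inputs of BLR 3.3/1 and 3.3/3)

Topic: `Literature/AlgebraicGeometry/Smoothening` (Bosch–Lütkebohmert–Raynaud, *Néron Models*,
§3.3: throughout the smoothening process the generic fibre `X_K` is smooth over `K`). For an
`R`-algebra `A` (a chart `X = Spec A` of an `R`-model) and `A' = A[1/ϖ]` (its generic fibre when
`K = R[1/ϖ]`, e.g. `R` a discrete valuation ring with uniformizer `ϖ`):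

* `formallySmooth_of_isLocalization_base` — if `A'` is a formally smooth `K`-algebra for a
  localisation `K` of `R` then `A'` is formally smooth over `R` (so `Ω[A'⁄R]` is projective,
  Mathlib `Algebra.FormallySmooth.projective_kaehlerDifferential` — the hypothesis of
  `DefectBoundProjective`);
* `isSmoothAt_of_not_mem` — if `A'` is formally smooth over `R` then `A` is smooth over `R` at
  every prime not containing `ϖ` (the local ring is a localisation of `A'`); in particular at
  the generic point `a⁻¹(0)` of a point `a : A → S` with values in a domain in which `ϖ ≠ 0`
  (`isSmoothAt_comap_bot`, the hypothesis `hQ` of `DefectZeroSmooth`).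

[folklore]; no named facts (D-0026).

## References

* S. Bosch, W. Lütkebohmert, M. Raynaud, *Néron Models*, Springer 1990, §3.3.
  [BLRNeronModels1990] (Not held; section number only.)
* The Stacks Project, Tag 00TB (smooth at a prime). [StacksProject]
-/

noncomputable section

namespace Literature.AlgebraicGeometry.Smoothening

universe u

/-- **Formally smooth over a localisation of the base is formally smooth over the base**: a
localisation `R → K` is formally smooth (Mathlib `Algebra.FormallySmooth.of_isLocalization`) and
formal smoothness composes. [folklore] -/
theorem formallySmooth_of_isLocalization_base (R K A' : Type u) [CommRing R] [CommRing K]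
    [CommRing A'] [Algebra R K] (M : Submonoid R) [IsLocalization M K] [Algebra K A'] [Algebra R A']
    [IsScalarTower R K A'] [Algebra.FormallySmooth K A'] : Algebra.FormallySmooth R A' :=
  haveI : Algebra.FormallySmooth R K := Algebra.FormallySmooth.of_isLocalization (Rₘ := K) M
  Algebra.FormallySmooth.comp R K A'

variable {R : Type u} [CommRing R] (ϖ : R) {A : Type u} [CommRing A] [Algebra R A]
  (A' : Type u) [CommRing A'] [Algebra A A'] [Algebra R A'] [IsScalarTower R A A']
  [IsLocalization.Away (algebraMap R A ϖ) A']

/-- **Smoothness of the generic fibre gives smoothness at the primes of the generic fibre**: if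
`A' = A[1/ϖ]` is formally smooth over `R` then `A` is smooth over `R` at every prime `q` with
`ϖ ∉ q` (`A_q` is a localisation of `A'`). [cite: StacksProject, Tag 00TB] -/
theorem isSmoothAt_of_not_mem [Algebra.FormallySmooth R A'] (q : Ideal A) [q.IsPrime]
    (hq : algebraMap R A ϖ ∉ q) : Algebra.IsSmoothAt R q := by
  have hle : Submonoid.powers (algebraMap R A ϖ) ≤ q.primeCompl := by
    rw [Submonoid.powers_le]
    exact hq
  -- `A' → A_q`
  have hunit : IsUnit (algebraMap A (Localization.AtPrime q) (algebraMap R A ϖ)) :=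
    IsLocalization.map_units (Localization.AtPrime q) ⟨_, hle (Submonoid.mem_powers _)⟩
  letI : Algebra A' (Localization.AtPrime q) :=
    (IsLocalization.Away.lift (algebraMap R A ϖ) (g := algebraMap A (Localization.AtPrime q))
      hunit).toAlgebra
  haveI : IsScalarTower A A' (Localization.AtPrime q) :=
    IsScalarTower.of_algebraMap_eq (R := A) (S := A') (A := Localization.AtPrime q) fun a =>
      (IsLocalization.Away.lift_eq (algebraMap R A ϖ) (g := algebraMap A (Localization.AtPrime q))
        hunit a).symm
  haveI : IsScalarTower R A' (Localization.AtPrime q) :=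
    IsScalarTower.of_algebraMap_eq (R := R) (S := A') (A := Localization.AtPrime q) fun r => by
      rw [IsScalarTower.algebraMap_apply R A A', ← IsScalarTower.algebraMap_apply A A',
        ← IsScalarTower.algebraMap_apply R A]
  -- `A_q` is a localisation of `A'`
  haveI : IsLocalization (q.primeCompl.map (algebraMap A A')) (Localization.AtPrime q) :=
    IsLocalization.isLocalization_of_submonoid_le A' (Localization.AtPrime q)
      (Submonoid.powers (algebraMap R A ϖ)) q.primeCompl hle
  haveI : Algebra.FormallySmooth A' (Localization.AtPrime q) :=
    Algebra.FormallySmooth.of_isLocalization (Rₘ := Localization.AtPrime q)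
      (q.primeCompl.map (algebraMap A A'))
  exact Algebra.FormallySmooth.comp R A' (Localization.AtPrime q)

/-- **`hQ` of `DefectZeroSmooth`**: if `A[1/ϖ]` is formally smooth over `R` then `A` is smooth over
`R` at the generic point `a⁻¹(0)` of every point `a : A → S` with values in a domain in which
`ϖ ≠ 0`. [folklore] -/
theorem isSmoothAt_comap_bot [Algebra.FormallySmooth R A'] (S : Type u) [CommRing S] [IsDomain S]
    [Algebra R S] [Algebra A S] [IsScalarTower R A S] (hϖ : algebraMap R S ϖ ≠ 0) :
    Algebra.IsSmoothAt R ((⊥ : Ideal S).comap (algebraMap A S)) := by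
  haveI : ((⊥ : Ideal S).comap (algebraMap A S)).IsPrime := Ideal.comap_isPrime _ _
  refine isSmoothAt_of_not_mem ϖ A' _ fun hmem => hϖ ?_
  rw [Ideal.mem_comap, Ideal.mem_bot, ← IsScalarTower.algebraMap_apply] at hmem
  exact hmem

end Literature.AlgebraicGeometry.Smoothening

end
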